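import Summits.QuantumFields.BalabanUV.Beta.GAN24.RespWordsLevelZero
import Summits.QuantumFields.BalabanUV.Beta.GAN24.T2RecChargeStepFourFace
import Summits.QuantumFields.BalabanUV.Beta.GAN24.WilsonBiStencilCornerSupport

/-!
# `BalabanUV.Beta.GAN24.MemberOneZeroModeLevelZero` — binder row G-an2-4 ∕ (CONV-C), W-slot CT-W, conservation law (C)∕(C)sym, steps (L4b)+(L5) of this lineage's note
# `HOME/b2b-balaban-gan24-formalise-leaf-04/g67/CSYM-LEVEL0-KERNEL-BLUEPRINT.md` §9: **THE ff ZERO MODE OF THE DRESSED COMB MEMBER `1` IN CLOSED FORM** — p2's one-step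
# charge law `zmode_succ_eq_fourFace` at `j = 0`, `N = Lc`, with ITS SOURCE TERM EVALUATED by 40 `zmode_dressedSource_level0_an1_closed` ((I)+(II): the two `S^E ⊗ S^E` numbers,
# the response words being `0`) and ITS CONTACT TERM EVALUATED by leaf-02 g62's `fourFace_memberZero_mul_eq_pow_mul_zmode` ((III): `Lc⁴·FF_Lc(T̃_0) = Lc^{4−#S}·zmode Lc T̃_0`)
# and `zmode_memberZero_eq` (`zmode Lc T̃_0 = cE₂·zmode Lc (wilsonW₂ d Tc)`): for every pattern `(μ,ν;α,β)`, with `Z(μ,ν) := zmode Lc (wilsonW₂ d Tc) μ ν (inl α) (inl β)`,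
# `#S := #{μ,ν,α,β}`, `E := [μ=ν][α=β] − [μ=β][α=ν]`, `E′ := [ν=μ][α=β] − [ν=β][α=μ]`, level-0 units `s_f = sfStep Lc 0`, `s_m = smStep d Lc 0`, `σ₀ = (Lc^1)^{−(d+2)}`,
# `K₁ = (Lc s_m s_f σ₀)((s_f s_m)⁻¹ s_f⁻² cE)`:
#   `zmode Lc T̃_1 (μ,ν;α,β) = (cE₂Lc^{2(d+1)})·(−(s_f s_m σ₀)²Lc²)·(−K₁²s_f²(E + E′)·½Lc^{d−1}(Lc^{d+1} − Lc^{d−1}))`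
#   `                        + Lc^{d+1}·(cE₂Lc^{2(d+1)})·(½·((Lc^{d+2})⁻¹)⁴)·(Lc^{4−#S}·cE₂·Z(μ,ν) + Lc^{4−#S}·cE₂·Z(ν,μ))`
# — NO `tsum` LEFT: (C)_0 of record (leaf-01 g73 `RowCChargeForms.zsymMember_succ_eq_iff_rowC`: `zmodeSym Lc T̃_1 = zmodeSym Lc T̃_0 = cE₂·(Z(μ,ν) + Z(ν,μ))`) is now ONE SCALAR
# IDENTITY per pattern in `cE, cE₂, Lc, d` and the three-fold charges `Z` of an3's Wilson bi-stencil at the literal's `Tc`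

NOT IN PRINT; OUR BOOKKEEPING ([folklore] four `rw` BY NAME: road-P2 g36's `T2RecChargeStepFourFace.zmode_succ_eq_fourFace`, this lineage's 40
`RespWordsLevelZero.zmode_dressedSource_level0_an1_closed`, leaf-02 g62's `WilsonBiStencilCornerSupport.fourFace_memberZero_mul_eq_pow_mul_zmode ∕ zmode_memberZero_eq`; G-an2-4 formalisation
swarm, leaf prover `b2b-balaban-gan24-formalise-leaf-04`, gen 67).  HONEST FRAMING (cell contract, verbatim): «discharging `BetaPertH` makes Bałaban's UV stability UNCONDITIONAL — a
real constructive-QFT result; it is NOT the continuum limit and NOT the Clay problem.»  HONEST DEPENDENCY (verbatim): «continuum YM on T⁴ ⇐ BetaPertH ∧ nine spine estimates (0/9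
proved); BetaPertH ⇐ (D1) ∧ (D4) ∧ CAP+tail; G-an2-4 gates asym, D1 and NE2/3/4.»

WHAT ([folklore]; generic `d`; in-block root, `1 ≤ Lc`, all colour constants symbolic, NO pin; `Tc` with vanishing box sums (the literal's `(8M²)⁻¹ • wsym22 M` by leaf-02's
`boxSums_smul ∘ boxSums_wsym22`); an1-type border rows `hBff hBmm hB hBt` displayed as in p2's file; 0 `def`, 0 cited facts, 0 `def … : Prop`, 0 sorry):
**`zmode_member_one_eq`** (the display above), **`zmode_member_one_eq_wsym22`** (`Tc := c • wsym22 M`, no table hypothesis) and **`zmode_member_one_eq_closed`** (`1 ≤ d`, units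
`s_f = s_m = 1` evaluated: source term `½·cE₂·cE²·(E + E′)·(Lc² − 1)·Lc⁻⁴`, contact term `½·cE₂²·Lc^{4−#S}·(Lc^{d−1}Lc⁶)⁻¹·(Z(μ,ν) + Z(ν,μ))`).  READING (docstring only): at the pin
`cE₂ = Lc^{d+5}` of `RowCChargeForms` and on the charged patterns (`#S = 2`) (C)_0 reads `cE²·Lc⁻⁴·(E + E′) = −(Z(μ,ν) + Z(ν,μ))` — a statement about the literal's `Tc` and `cE`
that this file does NOT decide.  Asserts NO value of Bałaban's tables beyond an3's ∕ an1's DEFINED ones; discharges NOTHING of (C) ∕ (C)sym ∕ (Q-D) ∕ (Q-D-rate) ∕ «T2Shape» ∕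
«T2Drift» ∕ (hW, hWall); NEVER «G-an2-4 closed» as (CONV-C); NOT D1, NOT `BetaPertH`, NOT continuum, NOT Clay.  2026-08-23; no existing file touched.
-/

noncomputable section

open Finset
open scoped BigOperators
open Literature.MathematicalPhysics.QuantumFieldTheory
open Literature.MathematicalPhysics.QuantumFieldTheory.Balaban1983to89
open Literature.MathematicalPhysics.QuantumFieldTheory.Balaban1983to89.Beta
open AffineAveraging (Site box toSite)
open ExpKernelCalculus (MKer shiftK)
open OneStepResolventKernel (Fib)
open OneStepKernelFamily (KInvStep)
open BalabanCompositeJets (LocStencil₂)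
open WilsonVertex2Sym (wsym22)
open WilsonBiStencil (wilsonW₂)
open AveragingMixedJetTables (mixFFAt)
open Summit.QuantumFields.BalabanUV.Beta.SecondOrderUnits (unitS₂)
open Summit.QuantumFields.BalabanUV.Beta.SpineRooted (T2RecAt)
open Summit.QuantumFields.BalabanUV.Beta.GAN24.CombesThomas (sfStep smStep)
open Summit.QuantumFields.BalabanUV.Beta.GAN24.BiStencilZeroMode (Tab zmode)
open Summit.QuantumFields.BalabanUV.Beta.GAN24.T2RecChargeStepFourFace (zmode_succ_eq_fourFace)
open Summit.QuantumFields.BalabanUV.Beta.GAN24.WilsonBiStencilCornerSupport (fourFace_memberZero_mul_eq_pow_mul_zmode zmode_memberZero_eq boxSums_smul boxSums_wsym22)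
open Summit.QuantumFields.BalabanUV.Beta.GAN24.RespWordsLevelZero (zmode_dressedSource_level0_an1_closed)

namespace Summit.QuantumFields.BalabanUV.Beta.GAN24.MemberOneZeroModeLevelZero

variable {d : ℕ} {Lc : ℕ} [NeZero Lc] {r : Fin (d + 1) → ℕ}

/-- NOT IN PRINT; OUR BOOKKEEPING.  **THE ff ZERO MODE OF THE DRESSED COMB MEMBER `1` IN CLOSED FORM** (statement in the header): p2's `zmode_succ_eq_fourFace` at `j = 0`, `N = Lc`,
the source by 40 `zmode_dressedSource_level0_an1_closed`, the two four-face terms by leaf-02's `fourFace_memberZero_mul_eq_pow_mul_zmode` and `zmode_memberZero_eq`. -/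
theorem zmode_member_one_eq (hLc : 1 ≤ Lc) (hr : r ∈ box (d + 1) Lc) (cE cVH cΛ cE₂ cB : ℝ) (Tc : Fin 4 → Fin 4 → Fin 4 → Fin 4 → ℝ)
    (hT : ∀ i j k l : Fin 4, ∑ k' ∈ ({k, k.rev} : Finset (Fin 4)), ∑ l' ∈ ({l, l.rev} : Finset (Fin 4)), ∑ i' ∈ ({i, i.rev} : Finset (Fin 4)),
      ∑ j' ∈ ({j, j.rev} : Finset (Fin 4)), Tc i' j' k' l' = 0)
    {vh₂S : Tab d} (hBff : ∀ κ u κ' u' x z (α β : Fin (d + 1)), vh₂S κ u κ' u' x z (Sum.inl α) (Sum.inl β) = 0)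
    (hBmm : ∀ κ u κ' u' x z (μ ν : Fin (d + 1)), vh₂S κ u κ' u' x z (Sum.inr μ) (Sum.inr ν) = 0)
    (hB : ∃ C δ : ℝ, 0 < δ ∧ LocStencil₂ vh₂S C δ)
    (hBt : ∀ (κ : Fin (d + 1)) (u : Fin (d + 1) → ℤ) (κ' : Fin (d + 1)) (u' t : Fin (d + 1) → ℤ),
      vh₂S κ (u + (Lc : ℤ) • t) κ' (u' + (Lc : ℤ) • t) = shiftK (-((Lc : ℤ) • t)) (vh₂S κ u κ' u'))
    (μ ν α β : Fin (d + 1)) :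
    zmode Lc (unitS₂ (sfStep Lc (0 + 1)) (smStep d Lc (0 + 1)) (T2RecAt d Lc (toSite r) cE cVH cΛ cE₂ cB Tc vh₂S (mixFFAt (toSite r) Lc) (0 + 1))) μ ν (Sum.inl α) (Sum.inl β)
      = (cE₂ * (Lc : ℝ) ^ (2 * (d + 1))) *
          (-((sfStep Lc 0 * smStep d Lc 0 * ((((Lc ^ (0 + 1) : ℕ) : ℝ)) ^ (d + 1 + 1))⁻¹) * (sfStep Lc 0 * smStep d Lc 0 * ((((Lc ^ (0 + 1) : ℕ) : ℝ)) ^ (d + 1 + 1))⁻¹)) *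
            ((Lc : ℝ) * (Lc : ℝ))) *
          (-(((((Lc : ℝ) * (smStep d Lc 0 * sfStep Lc 0)) * ((((Lc ^ (0 + 1) : ℕ) : ℝ)) ^ (d + 1 + 1))⁻¹) *
                ((sfStep Lc 0 * smStep d Lc 0)⁻¹ * ((sfStep Lc 0)⁻¹ * (sfStep Lc 0)⁻¹) * cE))) ^ 2 * (sfStep Lc 0 * sfStep Lc 0) *
              (((if μ = ν ∧ α = β then (1 : ℝ) else 0) - (if μ = β ∧ α = ν then (1 : ℝ) else 0)) * ((1 / 2 : ℝ) * (Lc : ℝ) ^ (d - 1) * ((Lc : ℝ) ^ (d + 1) - (Lc : ℝ) ^ (d - 1)))) +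
            -(((((Lc : ℝ) * (smStep d Lc 0 * sfStep Lc 0)) * ((((Lc ^ (0 + 1) : ℕ) : ℝ)) ^ (d + 1 + 1))⁻¹) *
                ((sfStep Lc 0 * smStep d Lc 0)⁻¹ * ((sfStep Lc 0)⁻¹ * (sfStep Lc 0)⁻¹) * cE))) ^ 2 * (sfStep Lc 0 * sfStep Lc 0) *
              (((if ν = μ ∧ α = β then (1 : ℝ) else 0) - (if ν = β ∧ α = μ then (1 : ℝ) else 0)) * ((1 / 2 : ℝ) * (Lc : ℝ) ^ (d - 1) * ((Lc : ℝ) ^ (d + 1) - (Lc : ℝ) ^ (d - 1))))) +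
        ((Lc : ℝ) ^ (d + 1)) * ((cE₂ * (Lc : ℝ) ^ (2 * (d + 1))) * ((1 / 2 : ℝ) * (((Lc : ℝ) ^ (d + 1 + 1))⁻¹) ^ 4) *
          ((Lc : ℝ) ^ (4 - ({μ, ν, α, β} : Finset (Fin (d + 1))).card) * (cE₂ * zmode Lc (wilsonW₂ d Tc) μ ν (Sum.inl α) (Sum.inl β)) +
           (Lc : ℝ) ^ (4 - ({ν, μ, α, β} : Finset (Fin (d + 1))).card) * (cE₂ * zmode Lc (wilsonW₂ d Tc) ν μ (Sum.inl α) (Sum.inl β)))) := by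
  rw [zmode_succ_eq_fourFace hLc hr cE cVH cΛ cE₂ cB Tc hBff hBmm hB hBt Lc 0 μ ν α β,
    zmode_dressedSource_level0_an1_closed hLc hr (sfStep Lc 0) (smStep d Lc 0) cE cVH cΛ hBff (cE₂ * (Lc : ℝ) ^ (2 * (d + 1))) cB μ ν α β,
    fourFace_memberZero_mul_eq_pow_mul_zmode hLc cE cVH cΛ cE₂ cB Tc hT (toSite r) hBff μ ν α β,
    fourFace_memberZero_mul_eq_pow_mul_zmode hLc cE cVH cΛ cE₂ cB Tc hT (toSite r) hBff ν μ α β,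
    zmode_memberZero_eq Lc cE cVH cΛ cE₂ cB Tc (toSite r) hBff μ ν α β, zmode_memberZero_eq Lc cE cVH cΛ cE₂ cB Tc (toSite r) hBff ν μ α β]

/-- NOT IN PRINT; OUR BOOKKEEPING.  **THE SAME AT THE D1 LITERAL's POSITION TABLE** `Tc := c • wsym22 M` (any scalar `c`, any colour rank `M`; the literal has `c = (8M²)⁻¹`): the box-sum
hypothesis is discharged by leaf-02's `boxSums_smul` ∘ `boxSums_wsym22` — NO table hypothesis left. -/
theorem zmode_member_one_eq_wsym22 (hLc : 1 ≤ Lc) (hr : r ∈ box (d + 1) Lc) (cE cVH cΛ cE₂ cB c : ℝ) (M : ℕ)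
    {vh₂S : Tab d} (hBff : ∀ κ u κ' u' x z (α β : Fin (d + 1)), vh₂S κ u κ' u' x z (Sum.inl α) (Sum.inl β) = 0)
    (hBmm : ∀ κ u κ' u' x z (μ ν : Fin (d + 1)), vh₂S κ u κ' u' x z (Sum.inr μ) (Sum.inr ν) = 0)
    (hB : ∃ C δ : ℝ, 0 < δ ∧ LocStencil₂ vh₂S C δ)
    (hBt : ∀ (κ : Fin (d + 1)) (u : Fin (d + 1) → ℤ) (κ' : Fin (d + 1)) (u' t : Fin (d + 1) → ℤ),
      vh₂S κ (u + (Lc : ℤ) • t) κ' (u' + (Lc : ℤ) • t) = shiftK (-((Lc : ℤ) • t)) (vh₂S κ u κ' u'))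
    (μ ν α β : Fin (d + 1)) :
    zmode Lc (unitS₂ (sfStep Lc (0 + 1)) (smStep d Lc (0 + 1)) (T2RecAt d Lc (toSite r) cE cVH cΛ cE₂ cB (c • wsym22 M) vh₂S (mixFFAt (toSite r) Lc) (0 + 1))) μ ν (Sum.inl α) (Sum.inl β)
      = (cE₂ * (Lc : ℝ) ^ (2 * (d + 1))) *
          (-((sfStep Lc 0 * smStep d Lc 0 * ((((Lc ^ (0 + 1) : ℕ) : ℝ)) ^ (d + 1 + 1))⁻¹) * (sfStep Lc 0 * smStep d Lc 0 * ((((Lc ^ (0 + 1) : ℕ) : ℝ)) ^ (d + 1 + 1))⁻¹)) *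
            ((Lc : ℝ) * (Lc : ℝ))) *
          (-(((((Lc : ℝ) * (smStep d Lc 0 * sfStep Lc 0)) * ((((Lc ^ (0 + 1) : ℕ) : ℝ)) ^ (d + 1 + 1))⁻¹) *
                ((sfStep Lc 0 * smStep d Lc 0)⁻¹ * ((sfStep Lc 0)⁻¹ * (sfStep Lc 0)⁻¹) * cE))) ^ 2 * (sfStep Lc 0 * sfStep Lc 0) *
              (((if μ = ν ∧ α = β then (1 : ℝ) else 0) - (if μ = β ∧ α = ν then (1 : ℝ) else 0)) * ((1 / 2 : ℝ) * (Lc : ℝ) ^ (d - 1) * ((Lc : ℝ) ^ (d + 1) - (Lc : ℝ) ^ (d - 1)))) +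
            -(((((Lc : ℝ) * (smStep d Lc 0 * sfStep Lc 0)) * ((((Lc ^ (0 + 1) : ℕ) : ℝ)) ^ (d + 1 + 1))⁻¹) *
                ((sfStep Lc 0 * smStep d Lc 0)⁻¹ * ((sfStep Lc 0)⁻¹ * (sfStep Lc 0)⁻¹) * cE))) ^ 2 * (sfStep Lc 0 * sfStep Lc 0) *
              (((if ν = μ ∧ α = β then (1 : ℝ) else 0) - (if ν = β ∧ α = μ then (1 : ℝ) else 0)) * ((1 / 2 : ℝ) * (Lc : ℝ) ^ (d - 1) * ((Lc : ℝ) ^ (d + 1) - (Lc : ℝ) ^ (d - 1))))) +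
        ((Lc : ℝ) ^ (d + 1)) * ((cE₂ * (Lc : ℝ) ^ (2 * (d + 1))) * ((1 / 2 : ℝ) * (((Lc : ℝ) ^ (d + 1 + 1))⁻¹) ^ 4) *
          ((Lc : ℝ) ^ (4 - ({μ, ν, α, β} : Finset (Fin (d + 1))).card) * (cE₂ * zmode Lc (wilsonW₂ d (c • wsym22 M)) μ ν (Sum.inl α) (Sum.inl β)) +
           (Lc : ℝ) ^ (4 - ({ν, μ, α, β} : Finset (Fin (d + 1))).card) * (cE₂ * zmode Lc (wilsonW₂ d (c • wsym22 M)) ν μ (Sum.inl α) (Sum.inl β)))) :=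
  zmode_member_one_eq hLc hr cE cVH cΛ cE₂ cB (c • wsym22 M) (fun i j k l => boxSums_smul (fun i j k l => boxSums_wsym22 M i j k l) c i j k l) hBff hBmm hB hBt μ ν α β


/-- NOT IN PRINT; OUR BOOKKEEPING.  **THE SAME, SIMPLIFIED** (`1 ≤ d`; level-0 units `s_f = s_m = 1`): with `Z(μ,ν) := zmode Lc (wilsonW₂ d Tc) μ ν (inl α) (inl β)` and `#S := #{μ,ν,α,β}`,
`zmode Lc T̃_1 (μ,ν;α,β) = ½·cE₂·cE²·(Lc² − 1)·(Lc⁴)⁻¹·((E) + (E′)) + ½·cE₂²·Lc^{4−#S}·(Lc^{d−1}·Lc⁶)⁻¹·(Z(μ,ν) + Z(ν,μ))` — the source is the EE exchange number, the contact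
term the `Lc^{4−#S}`-aliased charge of member `0`. -/
theorem zmode_member_one_eq_closed (hd : 1 ≤ d) (hLc : 1 ≤ Lc) (hr : r ∈ box (d + 1) Lc) (cE cVH cΛ cE₂ cB : ℝ) (Tc : Fin 4 → Fin 4 → Fin 4 → Fin 4 → ℝ)
    (hT : ∀ i j k l : Fin 4, ∑ k' ∈ ({k, k.rev} : Finset (Fin 4)), ∑ l' ∈ ({l, l.rev} : Finset (Fin 4)), ∑ i' ∈ ({i, i.rev} : Finset (Fin 4)),
      ∑ j' ∈ ({j, j.rev} : Finset (Fin 4)), Tc i' j' k' l' = 0)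
    {vh₂S : Tab d} (hBff : ∀ κ u κ' u' x z (α β : Fin (d + 1)), vh₂S κ u κ' u' x z (Sum.inl α) (Sum.inl β) = 0)
    (hBmm : ∀ κ u κ' u' x z (μ ν : Fin (d + 1)), vh₂S κ u κ' u' x z (Sum.inr μ) (Sum.inr ν) = 0)
    (hB : ∃ C δ : ℝ, 0 < δ ∧ LocStencil₂ vh₂S C δ)
    (hBt : ∀ (κ : Fin (d + 1)) (u : Fin (d + 1) → ℤ) (κ' : Fin (d + 1)) (u' t : Fin (d + 1) → ℤ),
      vh₂S κ (u + (Lc : ℤ) • t) κ' (u' + (Lc : ℤ) • t) = shiftK (-((Lc : ℤ) • t)) (vh₂S κ u κ' u'))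
    (μ ν α β : Fin (d + 1)) :
    zmode Lc (unitS₂ (sfStep Lc (0 + 1)) (smStep d Lc (0 + 1)) (T2RecAt d Lc (toSite r) cE cVH cΛ cE₂ cB Tc vh₂S (mixFFAt (toSite r) Lc) (0 + 1))) μ ν (Sum.inl α) (Sum.inl β)
      = (1 / 2 : ℝ) * cE₂ * cE ^ 2 * ((Lc : ℝ) ^ 2 - 1) * ((Lc : ℝ) ^ 4)⁻¹ *
            ((((if μ = ν ∧ α = β then (1 : ℝ) else 0) - (if μ = β ∧ α = ν then (1 : ℝ) else 0)) +
              ((if ν = μ ∧ α = β then (1 : ℝ) else 0) - (if ν = β ∧ α = μ then (1 : ℝ) else 0)))) +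
        (1 / 2 : ℝ) * cE₂ ^ 2 * (Lc : ℝ) ^ (4 - ({μ, ν, α, β} : Finset (Fin (d + 1))).card) * ((Lc : ℝ) ^ (d - 1) * (Lc : ℝ) ^ 6)⁻¹ *
          (zmode Lc (wilsonW₂ d Tc) μ ν (Sum.inl α) (Sum.inl β) + zmode Lc (wilsonW₂ d Tc) ν μ (Sum.inl α) (Sum.inl β)) := by
  rw [zmode_member_one_eq hLc hr cE cVH cΛ cE₂ cB Tc hT hBff hBmm hB hBt μ ν α β]
  have hL : (Lc : ℝ) ≠ 0 := by exact_mod_cast (show Lc ≠ 0 by omega)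
  have hS : ({ν, μ, α, β} : Finset (Fin (d + 1))) = {μ, ν, α, β} := Finset.insert_comm ν μ {α, β}
  have hP1 : (Lc : ℝ) ^ (d + 1) = (Lc : ℝ) ^ (d - 1) * (Lc : ℝ) ^ 2 := by rw [← pow_add]; congr 1; omega
  have hP2 : (Lc : ℝ) ^ (d + 1 + 1) = (Lc : ℝ) ^ (d - 1) * (Lc : ℝ) ^ 3 := by rw [← pow_add]; congr 1; omega
  have hP3 : (Lc : ℝ) ^ (2 * (d + 1)) = ((Lc : ℝ) ^ (d - 1)) ^ 2 * (Lc : ℝ) ^ 4 := by rw [← pow_mul, ← pow_add]; congr 1; omega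
  have hsf : sfStep Lc 0 = 1 := by simp [sfStep]
  have hsm : smStep d Lc 0 = 1 := by simp [smStep]
  have hc : (((Lc ^ (0 + 1) : ℕ) : ℝ)) = (Lc : ℝ) := by push_cast; ring
  rw [hS, hsf, hsm, hc, hP1, hP2, hP3]
  have hP : (Lc : ℝ) ^ (d - 1) ≠ 0 := pow_ne_zero _ hL
  field_simp
  ring

end Summit.QuantumFields.BalabanUV.Beta.GAN24.MemberOneZeroModeLevelZero

end
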